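import Summits.MatrixMultiplication.MatrixMultiplication.Theorems.OutsiderSandwichDelayThree
import Summits.MatrixMultiplication.MatrixMultiplication.Theorems.OutsiderSandwichGluingGain
import Summits.MatrixMultiplication.MatrixMultiplication.Theorems.OutsiderSandwichTightSubrank
import HarnessLib

/-!
# Yield with multiplicity: `C₁^{⊠2} ⊵ ⟨2⟩ ⊠ ⟨2,2,2⟩` and `C₁ ⊕ ⟨1,1,2⟩ ⊵ ⟨2,2,2⟩`

Route `OutsiderSandwich` (decomposition cell `decomp-mm`, lens 4 «minimal counterexample /
extremal reduction», gen 28), support for the aside leaf `BlockOneIsMM`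
(stmt-MatrixMultiplication-27147).

`OutsiderSandwichDelayThree` factorised the delay rung `C₁^{⊠4} ⊵ ⟨2,2,2⟩^{⊠3}` through the
twisted star `𝔖 = 𝔖₂(1)` (`C₁ = rotate 𝔖`) and the spare pair `U = ⟨1,1,2⟩`:
`[𝔖] ≥ 2[U]` (diagonal matrix) and `[𝔖][U] ≥ [M]`, `M = ⟨2,2,2⟩`.  This file records the two
exact level-one rungs WITH MULTIPLICITY that these give, and types the census instrument I82
(`decomp-mm-census` g23, answer to this seat's ask I-g27c):

1. **Double yield** `[𝔖]^2 ≥ 2[M]`: two Kronecker FACTORS of the block already restrict to two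
   independent copies of `⟨2,2,2⟩` (`twistedStar_sq_restrictsTo_unitTwo_kronecker_matMul`; over `ℂ`
   `coupling₁_sq_restrictsTo_unitTwo_kronecker_matMul`), and `C₁^{⊠2k} ⊵ ⟨2^k⟩ ⊠ ⟨2,2,2⟩^{⊠k}`.
2. **Sum cover** (census I82(b), exact `{0,±1}` certificate, here a proof):
   `𝔖 ⊕ ⟨1,1,2⟩ ⊵ ⟨2,2,2⟩` — the identity `X y₂ = Xᵀ y₂ + (x₀₁ − x₁₀)·J y₂`, `J = E₀₁ − E₁₀`:
   column one of `XY` is read off the coherent leaf, column two off the TWISTED leaf corrected by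
   ONE scalar-times-pair product (`directSum_twistedStar_matMul112_restrictsTo_matMul`).  Hence
   `[M] ≤ [𝔖] + [U]`, and with `2[U] ≤ [𝔖]`: **`2[M] ≤ 3[𝔖]`** — three copies of the block give
   two products (`unitThree_coupling₁_restrictsTo_unitTwo_matMul`), an amortised exchange `3/2`
   at level one against the unamortised `r(1) = 2` (`exchangeRate_one`).
3. At every universal spectral point `F`: `2·F⟨2,2,2⟩ ≤ F(C₁)^2` and `2·F⟨2,2,2⟩ ≤ 3·F(C₁)`
   (`spectral_yield`).

Placement.  None of this moves `θ⋆` (the tree has `θ⋆ ≤ ω − 2`); the content is structural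
bookkeeping for the leaf `BlockOneIsMM ⟺ θ⋆ = 0`: the antisymmetric letter of the block is worth
exactly one spare pair `⟨1,1,2⟩` at level one, in both directions (`[𝔖] ≥ 2[U]`,
`[𝔖] + [U] ≥ [M]`, `[𝔖]·[U] ≥ [M]`).

## References

* D. Coppersmith, S. Winograd, *Matrix multiplication via arithmetic progressions*,
  J. Symbolic Comput. 9 (1990) 251–280, §7. [CoppersmithWinograd1990]
* M. Bläser, *Fast Matrix Multiplication*, Theory of Computing Graduate Surveys 5 (2013), §5.
  [Blaser2013]
* M. Christandl, P. Vrana, J. Zuiddam, *Universal points in the asymptotic spectrum of tensors*,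
  J. Amer. Math. Soc. 36 (2023) 31–79, §1.1. [ChristandlVranaZuiddam2023]
* V. Strassen, *The asymptotic spectrum of tensors*, J. reine angew. Math. 384 (1988) 102–152,
  Thm. 3.8. [Strassen1988]
-/

noncomputable section

open scoped BigOperators

set_option linter.dupNamespace false
set_option autoImplicit false

namespace Summit.MatrixMultiplication.MatrixMultiplication.Theorems.OutsiderSandwichYield

open Literature.Computability.AlgebraicComplexity
open Summit.MatrixMultiplication.MatrixMultiplication.Theorems.OutsiderSandwichCoupling (coupling₁)
open Summit.MatrixMultiplication.MatrixMultiplication.Theorems.OutsiderSandwichDelayThree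
open Summit.MatrixMultiplication.MatrixMultiplication.Theorems.OutsiderSandwichGluingGain
  (directSumTensor_restrictsTo_add')
open Summit.MatrixMultiplication.MatrixMultiplication.Theorems.FarEdgeDescentTwistedStar
open Summit.MatrixMultiplication.MatrixMultiplication.Theorems.FarEdgeDescentCouplingBridge
  (coupling₁_restrictsTo_rotate_twistedStar)

/-! ## 1. Double yield: `[𝔖]^2 ≥ 2[⟨2,2,2⟩]` -/

section General

variable {K : Type} [Field K]

/-- **`2[⟨2,2,2⟩] ≤ [𝔖₂(1)]^2`** in `T(K)`: `2[M] ≤ 2[𝔖][U] = [𝔖]·(2[U]) ≤ [𝔖]·[𝔖]`.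
[cite: ChristandlVranaZuiddam2023, §1.1] -/
theorem two_mul_mk_matMul_le_mk_twistedStar_sq :
    (2 : TensorClass K) * TensorClass.mk (matMulTensor K 2 2 2) ≤
      TensorClass.mk (twistedStar K 2 1) ^ 2 := by
  set M := TensorClass.mk (matMulTensor K 2 2 2) with hM
  set S := TensorClass.mk (twistedStar K 2 1) with hS
  set U := TensorClass.mk (matMulTensor K 1 1 2) with hU
  calc (2 : TensorClass K) * M ≤ (2 : TensorClass K) * (S * U) :=
        TensorClass.mul_le_mul le_rfl mk_matMul_le_mk_twistedStar_mul_mk_matMul112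
    _ = S * ((2 : TensorClass K) * U) := by ring
    _ ≤ S * S := TensorClass.mul_le_mul le_rfl two_mul_mk_matMul112_le_mk_twistedStar
    _ = S ^ 2 := by ring

/-- **`𝔖₂(1)^{⊠2} ⊵ ⟨2⟩ ⊠ ⟨2,2,2⟩`**: two Kronecker factors of the twisted star restrict to two
independent `2 × 2` matrix products. [cite: ChristandlVranaZuiddam2023, §1.1] -/
theorem twistedStar_sq_restrictsTo_unitTwo_kronecker_matMul :
    TensorRestrictsTo (kroneckerPow (twistedStar K 2 1) 2)
      (kroneckerTensor (unitTensor K 2) (matMulTensor K 2 2 2)) := by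
  rw [← TensorClass.mk_le_mk_iff, ← TensorClass.mk_mul_mk, ← TensorClass.natCast_eq_mk,
    ← TensorClass.mk_pow]
  exact two_mul_mk_matMul_le_mk_twistedStar_sq

/-- `2^k [⟨2,2,2⟩]^k ≤ [𝔖₂(1)]^{2k}`. [cite: ChristandlVranaZuiddam2023, §1.1] -/
theorem pow_mul_mk_matMul_pow_le_mk_twistedStar_pow (k : ℕ) :
    (2 : TensorClass K) ^ k * TensorClass.mk (matMulTensor K 2 2 2) ^ k ≤
      TensorClass.mk (twistedStar K 2 1) ^ (2 * k) := by
  rw [← mul_pow, pow_mul]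
  exact (TensorClass.isStrassenPreorder K).pow_le_pow two_mul_mk_matMul_le_mk_twistedStar_sq k

/-- **`𝔖₂(1)^{⊠2k} ⊵ ⟨2^k⟩ ⊠ ⟨2,2,2⟩^{⊠k}`.** [cite: ChristandlVranaZuiddam2023, §1.1] -/
theorem twistedStar_pow_two_mul_restrictsTo (k : ℕ) :
    TensorRestrictsTo (kroneckerPow (twistedStar K 2 1) (2 * k))
      (kroneckerTensor (unitTensor K (2 ^ k)) (kroneckerPow (matMulTensor K 2 2 2) k)) := by
  rw [← TensorClass.mk_le_mk_iff, ← TensorClass.mk_mul_mk, ← TensorClass.natCast_eq_mk,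
    ← TensorClass.mk_pow, ← TensorClass.mk_pow, Nat.cast_pow, Nat.cast_ofNat]
  exact pow_mul_mk_matMul_pow_le_mk_twistedStar_pow k

/-! ## 2. Sum cover (census I82(b)): `𝔖₂(1) ⊕ ⟨1,1,2⟩ ⊵ ⟨2,2,2⟩` -/

/-- Column `k` of the `z`/`y`-variables goes to leaf `k` of the twisted star (column `0` to the
coherent leaf, column `1` to the twisted leaf). [cite: Blaser2013, §5] -/
def colLeaf (p : Fin 2 × Fin 2) : (Fin 2 × Fin 1) ⊕ (Fin 2 × Fin 1) :=
  if p.2 = 0 then Sum.inl (p.1, 0) else Sum.inr (p.1, 0)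

/-- The sign pattern of `J = E₀₁ − E₁₀`: `sgnJ i j = [i=0,j=1] − [i=1,j=0]`. [cite: Blaser2013, §5] -/
def sgnJ (i j : Fin 2) : K :=
  (if i = 0 ∧ j = 1 then 1 else 0) - (if i = 1 ∧ j = 0 then 1 else 0)

/-- The part of `⟨2,2,2⟩` read off the twisted star: `z₁ᵀ X y₁ + z₂ᵀ Xᵀ y₂` (a coordinate
restriction of `𝔖₂(1)`). [cite: Blaser2013, §5] -/
def starPart : Fin 2 × Fin 2 → Fin 2 × Fin 2 → Fin 2 × Fin 2 → K :=
  fun a b c => twistedStar K 2 1 (colLeaf a) b (colLeaf c)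

/-- The skew correction `z₂ᵀ (X − Xᵀ) y₂ = (x₀₁ − x₁₀) · z₂ᵀ J y₂`: one scalar-times-pair product.
[cite: Blaser2013, §5] -/
def skewCorr : Fin 2 × Fin 2 → Fin 2 × Fin 2 → Fin 2 × Fin 2 → K :=
  fun a b c => if a.2 = 1 ∧ c.2 = 1 then sgnJ b.1 b.2 * sgnJ a.1 c.1 else 0

/-- `𝔖₂(1) ⊵ starPart` (precomposition). [cite: Blaser2013, §5] -/
theorem twistedStar_restrictsTo_starPart : TensorRestrictsTo (twistedStar K 2 1) (starPart (K := K)) :=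
  tensorRestrictsTo_precomp (twistedStar K 2 1) colLeaf id colLeaf

/-- `⟨1,1,2⟩ ⊵ skewCorr`: the scalar is `x₀₁ − x₁₀`, the pair is `J y₂`, the output is column `z₂`
(explicit `{0,±1}` restriction maps). [cite: Blaser2013, §5] -/
theorem matMul112_restrictsTo_skewCorr : TensorRestrictsTo (matMulTensor K 1 1 2) (skewCorr (K := K)) := by
  have matMulTensor_apply' : ∀ (k m n : ℕ) (a : Fin k × Fin n) (b : Fin k × Fin m)
      (c : Fin m × Fin n),
      matMulTensor K k m n a b c = if a.1 = b.1 ∧ b.2 = c.1 ∧ a.2 = c.2 then 1 else 0 :=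
    fun _ _ _ _ _ _ => rfl
  refine ⟨fun a' a => if a'.2 = 1 ∧ a.2 = a'.1 then 1 else 0, fun b' _ => sgnJ b'.1 b'.2,
    fun c' c => if c'.2 = 1 then sgnJ c.2 c'.1 else 0, fun a' b' c' => ?_⟩
  obtain ⟨i, k⟩ := a'
  obtain ⟨i', j⟩ := b'
  obtain ⟨j', k'⟩ := c'
  simp only [Fintype.sum_prod_type, Fin.sum_univ_two, Fin.sum_univ_one, matMulTensor_apply',
    skewCorr, sgnJ]
  fin_cases i <;> fin_cases k <;> fin_cases i' <;> fin_cases j <;> fin_cases j' <;> fin_cases k' <;>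
    simp

/-- **The identity `X y₂ = Xᵀ y₂ + (x₀₁ − x₁₀) J y₂`** as tensors: `starPart + skewCorr = ⟨2,2,2⟩`.
[cite: Blaser2013, §5] -/
theorem starPart_add_skewCorr : starPart (K := K) + skewCorr = matMulTensor K 2 2 2 := by
  have matMulTensor_apply' : ∀ (k m n : ℕ) (a : Fin k × Fin n) (b : Fin k × Fin m)
      (c : Fin m × Fin n),
      matMulTensor K k m n a b c = if a.1 = b.1 ∧ b.2 = c.1 ∧ a.2 = c.2 then 1 else 0 :=
    fun _ _ _ _ _ _ => rfl
  funext a b c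
  obtain ⟨i, k⟩ := a
  obtain ⟨i', j⟩ := b
  obtain ⟨j', k'⟩ := c
  simp only [Pi.add_apply, starPart, skewCorr, colLeaf, sgnJ]
  fin_cases i <;> fin_cases k <;> fin_cases i' <;> fin_cases j <;> fin_cases j' <;> fin_cases k' <;>
    simp [matMulTensor_apply', Prod.swap]

/-- **`𝔖₂(1) ⊕ ⟨1,1,2⟩ ⊵ ⟨2,2,2⟩`** (census I82(b) as a theorem): the direct sum of the twisted star
and ONE spare scalar-times-pair restricts to `2 × 2` matrix multiplication.
[cite: ChristandlVranaZuiddam2023, §1.1] -/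
theorem directSum_twistedStar_matMul112_restrictsTo_matMul :
    TensorRestrictsTo (directSumTensor (twistedStar K 2 1) (matMulTensor K 1 1 2))
      (matMulTensor K 2 2 2) := by
  have h := (twistedStar_restrictsTo_starPart.directSum matMul112_restrictsTo_skewCorr).trans
    (directSumTensor_restrictsTo_add' (starPart (K := K)) skewCorr)
  rwa [starPart_add_skewCorr] at h

/-- `[⟨2,2,2⟩] ≤ [𝔖₂(1)] + [⟨1,1,2⟩]` in `T(K)`. [cite: ChristandlVranaZuiddam2023, §1.1] -/
theorem mk_matMul_le_mk_twistedStar_add_mk_matMul112 :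
    TensorClass.mk (matMulTensor K 2 2 2) ≤
      TensorClass.mk (twistedStar K 2 1) + TensorClass.mk (matMulTensor K 1 1 2) := by
  rw [TensorClass.mk_add_mk, TensorClass.mk_le_mk_iff]
  exact directSum_twistedStar_matMul112_restrictsTo_matMul

/-- **`2[⟨2,2,2⟩] ≤ 3[𝔖₂(1)]`**: `2[M] ≤ 2[𝔖] + 2[U] ≤ 2[𝔖] + [𝔖]`.
[cite: ChristandlVranaZuiddam2023, §1.1] -/
theorem two_mul_mk_matMul_le_three_mul_mk_twistedStar :
    (2 : TensorClass K) * TensorClass.mk (matMulTensor K 2 2 2) ≤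
      (3 : TensorClass K) * TensorClass.mk (twistedStar K 2 1) := by
  set M := TensorClass.mk (matMulTensor K 2 2 2) with hM
  set S := TensorClass.mk (twistedStar K 2 1) with hS
  set U := TensorClass.mk (matMulTensor K 1 1 2) with hU
  calc (2 : TensorClass K) * M ≤ (2 : TensorClass K) * (S + U) :=
        TensorClass.mul_le_mul le_rfl mk_matMul_le_mk_twistedStar_add_mk_matMul112
    _ = (2 : TensorClass K) * S + (2 : TensorClass K) * U := by ring
    _ ≤ (2 : TensorClass K) * S + S :=
        TensorClass.add_le_add le_rfl two_mul_mk_matMul112_le_mk_twistedStar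
    _ = (3 : TensorClass K) * S := by ring

/-- **`⟨3⟩ ⊠ 𝔖₂(1) ⊵ ⟨2⟩ ⊠ ⟨2,2,2⟩`**: three copies of the twisted star restrict to two
independent `2 × 2` products. [cite: ChristandlVranaZuiddam2023, §1.1] -/
theorem unitThree_twistedStar_restrictsTo_unitTwo_matMul :
    TensorRestrictsTo (kroneckerTensor (unitTensor K 3) (twistedStar K 2 1))
      (kroneckerTensor (unitTensor K 2) (matMulTensor K 2 2 2)) := by
  rw [← TensorClass.mk_le_mk_iff, ← TensorClass.mk_mul_mk, ← TensorClass.mk_mul_mk,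
    ← TensorClass.natCast_eq_mk, ← TensorClass.natCast_eq_mk, Nat.cast_ofNat, Nat.cast_ofNat]
  exact two_mul_mk_matMul_le_three_mul_mk_twistedStar

end General

/-! ## 3. Over `ℂ`, for the block `C₁ = rotate 𝔖₂(1)` -/

section Complex

/-- Transport along the rotation bridge: `⟨m⟩ ⊠ 𝔖^{⊠p} ⊵ ⟨n⟩ ⊠ M^{⊠q}` over `ℂ` gives
`⟨m⟩ ⊠ C₁^{⊠p} ⊵ ⟨n⟩ ⊠ ⟨2,2,2⟩^{⊠q}`. [cite: CoppersmithWinograd1990, §7] -/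
theorem transport_rotate {m n p q : ℕ}
    (h : TensorRestrictsTo (kroneckerTensor (unitTensor ℂ m) (kroneckerPow (twistedStar ℂ 2 1) p))
      (kroneckerTensor (unitTensor ℂ n) (kroneckerPow (matMulTensor ℂ 2 2 2) q))) :
    TensorRestrictsTo (kroneckerTensor (unitTensor ℂ m) (kroneckerPow coupling₁ p))
      (kroneckerTensor (unitTensor ℂ n) (kroneckerPow (matMulTensor ℂ 2 2 2) q)) := by
  have hr : TensorRestrictsTo
      (kroneckerTensor (rotate (unitTensor ℂ m)) (kroneckerPow (rotate (twistedStar ℂ 2 1)) p))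
      (kroneckerTensor (rotate (unitTensor ℂ n)) (kroneckerPow (rotate (matMulTensor ℂ 2 2 2)) q)) :=
    h.rotate
  rw [OutsiderSandwichTightSubrank.rotate_unitTensor,
    OutsiderSandwichTightSubrank.rotate_unitTensor] at hr
  have h₁ : TensorRestrictsTo (kroneckerTensor (unitTensor ℂ m) (kroneckerPow coupling₁ p))
      (kroneckerTensor (unitTensor ℂ m) (kroneckerPow (rotate (twistedStar ℂ 2 1)) p)) :=
    (TensorRestrictsTo.refl _).kronecker (coupling₁_restrictsTo_rotate_twistedStar.kroneckerPow p)
  have h₂ : TensorRestrictsTo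
      (kroneckerTensor (unitTensor ℂ n) (kroneckerPow (rotate (matMulTensor ℂ 2 2 2)) q))
      (kroneckerTensor (unitTensor ℂ n) (kroneckerPow (matMulTensor ℂ 2 2 2) q)) :=
    (TensorRestrictsTo.refl _).kronecker ((tensorRestrictsTo_rotate_matMulTensor ℂ 2 2 2).kroneckerPow q)
  exact (h₁.trans hr).trans h₂

/-- **`C₁^{⊠2k} ⊵ ⟨2^k⟩ ⊠ ⟨2,2,2⟩^{⊠k}`**: `2k` factors of the block yield `2^k` independent `k`-fold
products. [cite: CoppersmithWinograd1990, §7] -/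
theorem coupling₁_pow_two_mul_restrictsTo (k : ℕ) :
    TensorRestrictsTo (kroneckerPow coupling₁ (2 * k))
      (kroneckerTensor (unitTensor ℂ (2 ^ k)) (kroneckerPow (matMulTensor ℂ 2 2 2) k)) := by
  have h1 : TensorRestrictsTo (kroneckerTensor (unitTensor ℂ 1) (kroneckerPow (twistedStar ℂ 2 1) (2 * k)))
      (kroneckerTensor (unitTensor ℂ (2 ^ k)) (kroneckerPow (matMulTensor ℂ 2 2 2) k)) := by
    rw [← TensorClass.mk_le_mk_iff, ← TensorClass.mk_mul_mk, ← TensorClass.mk_mul_mk,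
      ← TensorClass.natCast_eq_mk, ← TensorClass.natCast_eq_mk, ← TensorClass.mk_pow,
      ← TensorClass.mk_pow, Nat.cast_pow, Nat.cast_ofNat, Nat.cast_one, one_mul]
    exact pow_mul_mk_matMul_pow_le_mk_twistedStar_pow k
  have h2 := transport_rotate h1
  have h3 : TensorRestrictsTo (kroneckerPow coupling₁ (2 * k))
      (kroneckerTensor (unitTensor ℂ 1) (kroneckerPow coupling₁ (2 * k))) := by
    rw [← TensorClass.mk_le_mk_iff, ← TensorClass.mk_mul_mk, ← TensorClass.natCast_eq_mk,
      Nat.cast_one, one_mul]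
  exact h3.trans h2

/-- **`C₁^{⊠2} ⊵ ⟨2⟩ ⊠ ⟨2,2,2⟩`** — DOUBLE YIELD: two Kronecker factors of lens 4's coupled block
already restrict to TWO independent `2 × 2` matrix products (the delay rung `Delayed 1 1 :
C₁^{⊠2} ⊵ ⟨2,2,2⟩` with multiplicity `2`). [cite: CoppersmithWinograd1990, §7] -/
theorem coupling₁_sq_restrictsTo_unitTwo_kronecker_matMul :
    TensorRestrictsTo (kroneckerPow coupling₁ 2)
      (kroneckerTensor (unitTensor ℂ 2) (kroneckerPow (matMulTensor ℂ 2 2 2) 1)) := by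
  simpa using coupling₁_pow_two_mul_restrictsTo 1

/-- **`⟨3⟩ ⊠ C₁ ⊵ ⟨2⟩ ⊠ ⟨2,2,2⟩`** — three copies of the block give two products: amortised
exchange `3/2` at level one (the unamortised rate is `r(1) = 2`, `exchangeRate_one`).
[cite: CoppersmithWinograd1990, §7] -/
theorem unitThree_coupling₁_restrictsTo_unitTwo_matMul :
    TensorRestrictsTo (kroneckerTensor (unitTensor ℂ 3) (kroneckerPow coupling₁ 1))
      (kroneckerTensor (unitTensor ℂ 2) (kroneckerPow (matMulTensor ℂ 2 2 2) 1)) := by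
  refine transport_rotate ?_
  rw [← TensorClass.mk_le_mk_iff, ← TensorClass.mk_mul_mk, ← TensorClass.mk_mul_mk,
    ← TensorClass.natCast_eq_mk, ← TensorClass.natCast_eq_mk, ← TensorClass.mk_pow,
    ← TensorClass.mk_pow, pow_one, pow_one, Nat.cast_ofNat, Nat.cast_ofNat]
  exact two_mul_mk_matMul_le_three_mul_mk_twistedStar

/-- **Spectral yield**: at every universal spectral point `F`, `2·F⟨2,2,2⟩ ≤ F(C₁)^2` and
`2·F⟨2,2,2⟩ ≤ 3·F(C₁)`. [cite: Strassen1988, Thm. 3.8] -/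
theorem spectral_yield {F : SpectralMap ℂ} (hF : IsUniversalSpectralPoint ℂ F) :
    2 * F (matMulTensor ℂ 2 2 2) ≤ F coupling₁ ^ 2 ∧
      2 * F (matMulTensor ℂ 2 2 2) ≤ 3 * F coupling₁ := by
  have h₁ := hF.mono _ _ coupling₁_sq_restrictsTo_unitTwo_kronecker_matMul
  have h₂ := hF.mono _ _ unitThree_coupling₁_restrictsTo_unitTwo_matMul
  rw [hF.map_kronecker, hF.map_kroneckerPow, hF.map_kroneckerPow, hF.map_unitTensor, pow_one] at h₁
  rw [hF.map_kronecker, hF.map_kronecker, hF.map_kroneckerPow, hF.map_kroneckerPow,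
    hF.map_unitTensor, hF.map_unitTensor, pow_one, pow_one] at h₂
  exact ⟨by exact_mod_cast h₁, by exact_mod_cast h₂⟩

end Complex

end Summit.MatrixMultiplication.MatrixMultiplication.Theorems.OutsiderSandwichYield
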